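import Mathlib
import Summits.NavierStokesRegularity.NavierStokesRegularity.Theses.ImplosionDoor
import Summits.NavierStokesRegularity.NavierStokesRegularity.Theorems.LocalSineTubeDoorProfileAlignedWindowRigidityAncient
import Literature.Analysis.FluidPDE.TypeIAncientMild
import Literature.Analysis.FluidPDE.MildSolution
import HarnessLib

/-!
# `ImplosionDoor.SphereFluxTangency` — incompressibility turns one-signed radial flux into
  tangency (item stmt-NavierStokesRegularity-25307)

**Statement (verbatim route decl).** For a profile `v` of the route's Type-I ancient Oseen-mild
class (rate `‖v(t,x)‖ ≤ C/√(−t)`, continuous on the open slab, unit-viscosity Oseen-mild between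
negative times, divergence-free slices): if `⟪v(s,y), y⟫ ≤ 0` for all `s < 0` and all `y`, then
`⟪v(s,y), y⟫ = 0` for all `s < 0` and all `y`.

PROOF. The class is jointly real-analytic on the open slab (tree:
`LocalSineTubeDoorProfileAlignedWindowRigidityAncient.analyticOnNhd_uncurry`), so every slice
`w = v(s,·)` is `C^∞`, its pointwise `div w = 0` is honest, and `w` is WEAKLY divergence free
(`IsTypeIAncientMild.isWeaklyDivFree`, Gauss–Green). The divergence theorem on balls is run in
its weak form with RADIAL test functions: for `0 < a < b` let `G(τ) = smoothTransition((τ−a)/(b−a))`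
and `θ(y) = G(|y|²) − 1 ∈ C_c^∞(ℝ³)`; then `∇θ(y) = 2G′(|y|²) y`, so
`0 = ∫ ⟪w, ∇θ⟫ = ∫ 2 G′(|y|²) ⟪w(y), y⟫ dy`. The integrand is `≤ 0` (`G′ ≥ 0`, `⟪w,y⟫ ≤ 0`),
continuous and compactly supported, hence it vanishes identically. If `⟪w(y₀), y₀⟫ < 0`, then
`⟪w, y⟫ < 0` near `y₀`, in particular along the ray points `(√τ/|y₀|) y₀` for `τ` near
`ρ₀ = |y₀|²`; choosing `[a, b] = [ρ₀ − ε, ρ₀ + ε]` inside that range forces `G′ ≡ 0` on `[a, b]`,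
contradicting `G(a) = 0`, `G(b) = 1` (mean value theorem).

HONEST FRAMING: a calculus lemma about a HYPOTHETICAL Type-I profile (support item of a door
route); nothing here bears on Navier–Stokes regularity.
-/

noncomputable section

set_option linter.dupNamespace false

namespace Summit.NavierStokesRegularity.NavierStokesRegularity.Theorems

open MeasureTheory Set Filter Topology Metric Function
open Literature.Analysis Literature.Analysis.FluidPDE
open scoped RealInnerProductSpace InnerProductSpace

namespace SphereFluxTangency

/-- **One-signed radial flux of a weakly divergence-free continuous field vanishes**: if `w` is
continuous, weakly divergence free and `⟪w(y), y⟫ ≤ 0` everywhere, then `⟪w(y), y⟫ = 0`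
everywhere (weak Gauss theorem on spheres: radial test functions `θ(y) = G(|y|²) − 1` with the
monotone smooth step `G(τ) = smoothTransition((τ − a)/(b − a))`, sign, continuity, and the mean
value theorem for `G` on `[a, b]`). [folklore] -/
theorem inner_self_eq_zero_of_nonpos {w : (EuclideanSpace ℝ (Fin 3)) → (EuclideanSpace ℝ (Fin 3))} (hw : Continuous w) (hdiv : IsWeaklyDivFree w)
    (hle : ∀ y, ⟪w y, y⟫_ℝ ≤ 0) : ∀ y, ⟪w y, y⟫_ℝ = 0 := by
  -- the radial flux density
  set f : (EuclideanSpace ℝ (Fin 3)) → ℝ := fun y => ⟪w y, y⟫_ℝ with hf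
  have hfc : Continuous f := hw.inner continuous_id
  -- KEY: for `0 < a < b` there is a level `c ∈ (a, b)` on whose sphere `f` vanishes
  have key : ∀ a b : ℝ, 0 < a → a < b → ∃ c ∈ Ioo a b, ∀ y : (EuclideanSpace ℝ (Fin 3)), ‖y‖ ^ 2 = c → f y = 0 := by
    intro a b ha hab
    have hb : 0 < b := ha.trans hab
    -- the smooth monotone step `G`: `0` below `a`, `1` above `b`
    obtain ⟨G, hGdef⟩ : ∃ G : ℝ → ℝ, G = fun τ => Real.smoothTransition ((τ - a) / (b - a)) :=
      ⟨_, rfl⟩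
    have hGcd : ContDiff ℝ (⊤ : ℕ∞) G := by
      rw [hGdef]
      exact Real.smoothTransition.contDiff.comp ((contDiff_id.sub contDiff_const).div_const _)
    have hGdiff : Differentiable ℝ G := hGcd.differentiable (by simp)
    have hGmono : Monotone G := by
      intro τ₁ τ₂ h
      rw [hGdef]
      exact Real.smoothTransition.monotone (div_le_div_of_nonneg_right (by linarith) (by linarith))
    have hGa : G a = 0 := by
      rw [hGdef]
      exact Real.smoothTransition.zero_of_nonpos (by rw [sub_self, zero_div])
    have hGge : ∀ τ, b ≤ τ → G τ = 1 := by
      intro τ hτ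
      rw [hGdef]
      exact Real.smoothTransition.one_of_one_le ((one_le_div (by linarith)).2 (by linarith))
    have hGd0 : ∀ τ, 0 ≤ deriv G τ := fun τ => hGmono.deriv_nonneg
    have hGd_gt : ∀ τ, b < τ → deriv G τ = 0 := by
      intro τ hτ
      have hev : G =ᶠ[𝓝 τ] fun _ => (1 : ℝ) := by
        filter_upwards [Ioi_mem_nhds hτ] with σ hσ
        exact hGge σ (le_of_lt hσ)
      rw [hev.deriv_eq, deriv_const]
    have hGdc : Continuous (deriv G) := hGcd.continuous_deriv (by exact_mod_cast le_top)
    -- the radial test function `θ(y) = G(|y|²) - 1`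
    obtain ⟨θ, hθdef⟩ : ∃ θ : (EuclideanSpace ℝ (Fin 3)) → ℝ, θ = fun y => G (‖y‖ ^ 2) - 1 := ⟨_, rfl⟩
    have hθcd : ContDiff ℝ (⊤ : ℕ∞) θ := by
      rw [hθdef]
      exact (hGcd.comp (contDiff_norm_sq ℝ)).sub contDiff_const
    have hθ0 : ∀ y : (EuclideanSpace ℝ (Fin 3)), b < ‖y‖ ^ 2 → θ y = 0 := by
      intro y hy
      rw [hθdef]
      show G (‖y‖ ^ 2) - 1 = 0
      rw [hGge _ hy.le, sub_self]
    have hout : ∀ y : (EuclideanSpace ℝ (Fin 3)), y ∉ closedBall (0 : (EuclideanSpace ℝ (Fin 3))) (Real.sqrt b + 1) → b < ‖y‖ ^ 2 := by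
      intro y hy
      rw [mem_closedBall, dist_zero_right, not_le] at hy
      have hsb : Real.sqrt b < ‖y‖ := by linarith
      have h1 : Real.sqrt b ^ 2 = b := Real.sq_sqrt hb.le
      nlinarith [Real.sqrt_nonneg b, norm_nonneg y]
    have hθsupp : HasCompactSupport θ :=
      HasCompactSupport.intro (isCompact_closedBall (0 : (EuclideanSpace ℝ (Fin 3))) (Real.sqrt b + 1))
        fun y hy => hθ0 y (hout y hy)
    have hθtest : FunctionSpaces.IsTestFunctionOn (⊤ : TopologicalSpace.Opens (EuclideanSpace ℝ (Fin 3))) θ :=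
      ⟨hθcd, hθsupp, fun _ _ => trivial⟩
    -- `∇θ(y) = 2 G′(|y|²) y`
    have hθgrad : ∀ y : (EuclideanSpace ℝ (Fin 3)), gradient θ y = (2 * deriv G (‖y‖ ^ 2)) • y := by
      intro y
      set d : ℝ := deriv G (‖y‖ ^ 2) with hd
      have hG : HasDerivAt G d (‖y‖ ^ 2) := (hGdiff _).hasDerivAt
      have hN : HasFDerivAt (fun y : (EuclideanSpace ℝ (Fin 3)) => ‖y‖ ^ 2) (2 • innerSL ℝ y) y :=
        (hasStrictFDerivAt_norm_sq y).hasFDerivAt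
      have hθ' : HasFDerivAt (G ∘ fun z : (EuclideanSpace ℝ (Fin 3)) => ‖z‖ ^ 2) (d • (2 • innerSL ℝ y)) y :=
        HasDerivAt.comp_hasFDerivAt (h₂ := G) (h₂' := d) y hG hN
      have hθ1 : HasFDerivAt θ (d • (2 • innerSL ℝ y)) y := by
        rw [hθdef]
        exact hθ'.sub_const 1
      have hL : (InnerProductSpace.toDual ℝ (EuclideanSpace ℝ (Fin 3))) ((2 * d) • y) = d • (2 • innerSL ℝ y) := by
        ext v
        rw [InnerProductSpace.toDual_apply_apply, real_inner_smul_left]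
        change _ = d • ((2 • innerSL ℝ y) v)
        rw [show (2 • innerSL ℝ y) v = 2 • (innerSL ℝ y v) from rfl, innerSL_apply_apply]
        simp only [smul_eq_mul, nsmul_eq_mul, Nat.cast_ofNat]
        ring
      have hgrad : HasGradientAt θ ((2 * d) • y) y := by
        rw [hasGradientAt_iff_hasFDerivAt, hL]
        exact hθ1
      exact hgrad.gradient
    -- the integrand `g(y) = 2 G′(|y|²) f(y)` integrates to zero (weak divergence-freeness)
    set g : (EuclideanSpace ℝ (Fin 3)) → ℝ := fun y => (2 * deriv G (‖y‖ ^ 2)) * f y with hg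
    have hint : ∫ y, g y = 0 := by
      rw [← hdiv θ hθtest]
      refine integral_congr_ae (ae_of_all _ fun y => ?_)
      simp only [hg, hθgrad, real_inner_smul_right, hf]
    -- `g ≤ 0`, continuous, compactly supported, hence `g ≡ 0`
    have hg0 : ∀ y, g y ≤ 0 := fun y =>
      mul_nonpos_of_nonneg_of_nonpos (mul_nonneg zero_le_two (hGd0 _)) (hle y)
    have hgc : Continuous g :=
      (continuous_const.mul (hGdc.comp (continuous_norm.pow 2))).mul hfc
    have hgs : HasCompactSupport g := by
      refine HasCompactSupport.intro (isCompact_closedBall (0 : (EuclideanSpace ℝ (Fin 3))) (Real.sqrt b + 1)) fun y hy => ?_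
      simp only [hg, hGd_gt _ (hout y hy), mul_zero, zero_mul]
    have hneg0 : (fun y => -g y) = fun _ => (0 : ℝ) := by
      have hi : Integrable (fun y => -g y) := (hgc.integrable_of_hasCompactSupport hgs).neg
      have hz : ∫ y, -g y = 0 := by rw [integral_neg, hint, neg_zero]
      have hae := (integral_eq_zero_iff_of_nonneg (fun y => neg_nonneg.2 (hg0 y)) hi).1 hz
      exact (hgc.neg.ae_eq_iff_eq (μ := (volume : Measure (EuclideanSpace ℝ (Fin 3)))) continuous_const).1 hae
    have hzero : ∀ y : (EuclideanSpace ℝ (Fin 3)), deriv G (‖y‖ ^ 2) * f y = 0 := by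
      intro y
      have := congr_fun hneg0 y
      simp only [hg, neg_eq_zero, mul_eq_zero] at this
      rcases this with (h | h) | h
      · exact absurd h two_ne_zero
      · rw [h, zero_mul]
      · rw [h, mul_zero]
    -- mean value theorem: some `c ∈ (a, b)` has `G′(c) ≠ 0` (as `G(a) = 0`, `G(b) = 1`)
    obtain ⟨c, hc, hcd⟩ := exists_deriv_eq_slope G hab hGdiff.continuous.continuousOn
      hGdiff.differentiableOn
    rw [hGa, hGge b le_rfl, sub_zero] at hcd
    have hGc : deriv G c ≠ 0 := by
      rw [hcd]
      exact div_ne_zero one_ne_zero (by linarith)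
    refine ⟨c, hc, fun y hy => ?_⟩
    have h := hzero y
    rw [hy] at h
    rcases mul_eq_zero.1 h with h | h
    · exact absurd h hGc
    · exact h
  -- suppose `f y₀ < 0`
  intro y₀
  by_contra hne
  have hneg : f y₀ < 0 := lt_of_le_of_ne (hle y₀) hne
  have hy₀ : y₀ ≠ 0 := by
    rintro rfl
    simp [hf] at hneg
  have hρ : 0 < ‖y₀‖ := norm_pos_iff.2 hy₀
  set ρ₀ : ℝ := ‖y₀‖ ^ 2 with hρ₀
  have hρ₀pos : 0 < ρ₀ := by positivity
  -- `f < 0` near `y₀`, hence along the ray points `(√τ/|y₀|) y₀` for `τ` near `ρ₀`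
  set ray : ℝ → (EuclideanSpace ℝ (Fin 3)) := fun τ => (Real.sqrt τ / ‖y₀‖) • y₀ with hray
  have hray_cont : Continuous ray := (Real.continuous_sqrt.div_const _).smul continuous_const
  have hray_ρ₀ : ray ρ₀ = y₀ := by
    simp only [hray, hρ₀, Real.sqrt_sq hρ.le, div_self hρ.ne', one_smul]
  have hray_norm : ∀ τ, 0 ≤ τ → ‖ray τ‖ ^ 2 = τ := by
    intro τ hτ
    rw [hray]
    simp only [norm_smul, norm_div, Real.norm_eq_abs, abs_of_nonneg (Real.sqrt_nonneg τ),
      abs_of_pos hρ, div_mul_cancel₀ _ hρ.ne', Real.sq_sqrt hτ]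
  have hev : ∀ᶠ τ in 𝓝 ρ₀, f (ray τ) < 0 := by
    have h1 : Tendsto (fun τ => f (ray τ)) (𝓝 ρ₀) (𝓝 (f (ray ρ₀))) :=
      (hfc.comp hray_cont).continuousAt
    rw [hray_ρ₀] at h1
    exact h1.eventually (gt_mem_nhds hneg)
  obtain ⟨ε, hε, hεball⟩ := Metric.eventually_nhds_iff.1 hev
  -- the shell `[a, b] = [ρ₀ - ε', ρ₀ + ε']` inside that range, with `a > 0`
  set ε' : ℝ := min (ε / 2) (ρ₀ / 2) with hε'
  have hε'pos : 0 < ε' := lt_min (by linarith) (by linarith)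
  have hε'ε : ε' < ε := lt_of_le_of_lt (min_le_left _ _) (by linarith)
  have hε'ρ : ε' < ρ₀ := lt_of_le_of_lt (min_le_right _ _) (by linarith)
  obtain ⟨c, hc, hcz⟩ := key (ρ₀ - ε') (ρ₀ + ε') (by linarith) (by linarith)
  have hc0 : 0 ≤ c := by linarith [hc.1]
  have hcd : dist c ρ₀ < ε := by
    rw [Real.dist_eq, abs_lt]
    constructor <;> [linarith [hc.1]; linarith [hc.2]]
  exact absurd (hcz (ray c) (hray_norm c hc0)) (hεball hcd).ne

end SphereFluxTangency

open SphereFluxTangency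
  Summit.NavierStokesRegularity.NavierStokesRegularity.Theorems.LocalSineTubeDoorProfileAlignedWindowRigidityAncient in
/-- **Item stmt-NavierStokesRegularity-25307** (`ImplosionDoor.SphereFluxTangency`): for a
profile of the route's Type-I ancient Oseen-mild class, one-signed radial flux `⟪v(s,y), y⟫ ≤ 0`
forces tangency `⟪v(s,y), y⟫ = 0` (slices are smooth by joint analyticity of the class, hence
weakly divergence free; weak Gauss theorem with radial test functions). [folklore] -/
theorem implosionDoor_sphereFluxTangency_proof :
    Summit.NavierStokesRegularity.NavierStokesRegularity.Theses.ImplosionDoor.SphereFluxTangency := by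
  unfold Summit.NavierStokesRegularity.NavierStokesRegularity.Theses.ImplosionDoor.SphereFluxTangency
  intro C v hrate hcont hmild hdiv hle s hs y
  -- the class is the tree's `IsTypeIAncientMild` (joint smoothness from joint analyticity)
  have hA : IsTypeIAncientMild C v := by
    refine ⟨(analyticOnNhd_uncurry hcont (bdd_of_hasTypeITimeDecay hrate) hmild).contDiffOn_of_completeSpace,
      fun t ht => hdiv t ht, fun s t hst ht x => ?_, hrate⟩
    rw [heatFlow_of_pos _ (sub_pos.2 hst)]
    exact hmild s t hst ht x
  exact inner_self_eq_zero_of_nonpos (hA.continuous_slice hs) (hA.isWeaklyDivFree hs) (hle s hs) y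

end Summit.NavierStokesRegularity.NavierStokesRegularity.Theorems

end
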